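import Literature.MathematicalPhysics.QuantumFieldTheory.King1986.EffectiveLaplacianSymbol
import HarnessLib

/-!
# King 1986, (4.2) ON THE TORUS: the plane-wave representation of the block-spin minimiser `ψ_φ = a_kG_kQ_k^*φ` for
# the ACTUAL operators of `EffectiveLaplacianSymbol`, its kernel `ℋ_k(x, b)`, and the bound by the alias amplitudes

**Citation header (reproduction of PUBLISHED work; seat `pub-ymgap-dag-n18-b` of the cell `pub-ymgap`, Track-A node
N18 = NE5 whose PRINTED MODEL of record is King's Prop. 3.8 — this is the representation «(4.2)» on which King's proof of
(3.71) rests («Using the representation (4.2), we shall now establish the last bound in (3.71)», p. 672); companion of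
`King1986/EffectiveLaplacianSymbol` ((4.5) as an operator identity: `hat_fineOp_inv`, `ft_transpose_Qmat`,
`sum_Cfib_mul_u`, `minimiser`, `effSym`) and of `King1986/MinimizerAliasModes` ∕ `…Rate` (the momentum-space estimates
(4.19)–(4.31) for the modes displayed here).**
C. King, *The U(1) Higgs model. I. The continuum limit*, Commun. Math. Phys. **102** (1986) 649–677 [King1986], §2
(2.13)–(2.15) p. 653 (the minimiser `ℋ_k = a_kG_kQ_k^*`), §4 (4.1)–(4.5) p. 670.  Page image READ AS IMAGE by this seat:
`b2b-balaban-template/king-renders/1986-cmp102-king-u1-higgs-I-p022-x2.png` (p. 670).  Architecture reference: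
T. Bałaban, J. Feldman, H. Knörrer, E. Trubowitz, *Bloch theory for periodic block spin transformations*,
arXiv:1609.00964 [BFKT2016Bloch], Lemma 6 (momentum kernels of products ∕ inverses), Lemma 9.  King's paper is TEMPLATE
LITERATURE (printed and proved `A = 0` mechanism); nothing here is about Bałaban's covariant objects.

**What King prints (verbatim, p. 670).**  «The basis for our proof is an explicit Fourier representation for
a_kG_kQ^*_k. We introduce a Fourier transform on ηZ^d by  f̃(p) = Σ_x η^de^{−ipx}f(x),  f(x) = (2π)^{−d}∫_{|p|≦π/η}
e^{ixp}f̃(p). (4.1)  By applying this to the equation defining G_k, it follows in a straightforward way (see [Ba 4]) that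
(a_kG_kQ^*_k)(x, y) = (2π)^{−d} ∫_{|p′|≦π} dp′ Δ^{(k)}(p′) Σ_l e^{i(p′+l)(x−y)} u^η_k(p′+l)/Δ^η(p′+l), (4.2)  where x ∈ ηZ^d,
y ∈ Z^d, p′ ∈ [−π, π), l ∈ 2πZ^d … u^η_k(p) = Π_{μ=1}^d [(e^{−ip_μ} − 1)η(e^{−iηp_μ} − 1)^{−1}], (4.3)  Δ^η(p) =
4η^{−2}Σ_{μ=1}^d sin²(1/2ηp_μ) + m²(L^kε)², (4.4)  Δ^{(k)}(p′) = (a_k^{−1} + Σ_l |u^η_k(p′+l)|²Δ^η(p′+l)^{−1})^{−1}. (4.5)»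

**What this file PROVES (kernel; imports `EffectiveLaplacianSymbol` only; NO `def`, no named fact), on every finite
torus** — unit torus `Ω = Π_μ ℤ/M_μ` (`Tor M`), fine torus `Ω_η = Π_μ ℤ/(NM_μ)` (`Tor (fine N M)`, `N = L^k = η⁻¹`),
`A₀ = c(−Δ) + m² + aQ*Q` (`fineOp`), minimiser `ψ_φ = aN^dA₀⁻¹Qᵀφ` (`minimiser`, = King's `a_kG_kQ_k^*φ` in unweighted
matrix conventions), the tree's transform `φ̃(p) = Σ_y φ(y)e^{−ip·y}` (`ft`), characters `e^{ip·x}` (`chi`), alias weight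
`u` (`TorusBlockForm.u`; the COMPLEX CONJUGATE of King's `u^η_k` at the same alias momentum), reduction `red` and fibres
`fib` (the aliases `p′ + l` of `p′`), symbol `σ = lapSym c m²` (= `Δ^η + m²` for `c = N²`), `S = Sfib`, `Δ^{(k)} = effSym
= a/(1 + aS)`; hypotheses `a ≥ 0`, `c ≥ 0`, `m² > 0` throughout:
* §1 `apply_eq_inversion` (`φ(y) = |Ω|⁻¹Σ_p φ̃(p)e^{ip·y}`), `ft_single` (`δ̃_b(q) = e^{−iq·b}`), **`ft_mulVec`**:
  `(Tv)^(p) = |Ω|⁻¹ Σ_{p′} conj T̂(p,p′)·v̂(p′)` (BFKT Lemma 6 in the tree's `hat` convention).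
* §2 `ft_fineOp_inv_mulVec` (`(A₀⁻¹v)^(p) = Σ_{p′∈fib(red p)} conj C_{red p}(p,p′) v̂(p′)` — the block-diagonal fibre
  inverse of `hat_fineOp_inv`), **`ft_fineOp_inv_transpose_Qmat`** (`(A₀⁻¹Qᵀφ)^(p) = Δ^η(p)⁻¹(1 + aS(q))⁻¹·conj u(p)·φ̃(q)`,
  `q = red p`, by Sherman–Morrison `Σ_{p′}C(p,p′)u(p′) = u(p)σ(p)⁻¹(1+aS)⁻¹`), `ft_minimiser`, and **KING'S (4.2) ON THE
  TORUS** `minimiser_eq_sum`:  `ψ_φ(x) = |Ω|⁻¹ Σ_{p∈Ω̂_η} Δ^{(k)}(red p)·Δ^η(p)⁻¹·conj u(p)·φ̃(red p)·e^{ip·x}` — the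
  `p`-sum is King's `∫dp′ Σ_l` (regrouped by fibres it is `Σ_q Σ_{p∈fib q}`); the kernel form `minimiser_kernel_eq_sum`
  (`φ = δ_b`: `ℋ_k(x,b) = |Ω|⁻¹Σ_p Δ^{(k)}(q)Δ^η(p)⁻¹ conj u(p) e^{−iq·b}e^{ip·x}`); and the bound by the ALIAS AMPLITUDES
  `abs_minimiser_kernel_le`: `|ℋ_k(x,b)| ≤ |Ω|⁻¹ Σ_q Σ_{p∈fib q} Δ^{(k)}(q)Δ^η(p)⁻¹‖u(p)‖` (the inner sums are the objects
  bounded uniformly by (4.20)–(4.22), `King1986/MinimizerAliasModes`).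

**NOT COVERED.**  The identification of the fibre `fib q` with King's digit set `{l : |l_μ| ≤ π(L^k − 1)}` and of
`u`, `σ`, `e^{ip·x}` with `uWeight`, `latticeSymbol`, `modePhase` of the momentum-space files (the torus ↔ momentum
dictionary — sequel), the two-spacing comparison itself (Prop. 3.8), free boundary conditions, `A ≠ 0`.  HONEST FRAMING:
King's `A = 0` scalar MODEL (template literature) on a finite torus with `m² > 0`; nothing continuum ∕ mass-gap ∕ Clay;
count-neutral for the cell's 27 nodes.
-/

noncomputable section

open Finset Real Matrix
open scoped BigOperators ComplexConjugate

namespace Literature.MathematicalPhysics.QuantumFieldTheory.King1986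

open Literature.MathematicalPhysics.QuantumFieldTheory.Balaban1983to89
open Literature.MathematicalPhysics.QuantumFieldTheory.Balaban1983to89.B5Prop11Plancherel

namespace Torus

variable {d : ℕ}

/-! ## §1 Fourier transform of a matrix–vector product and of a point source -/

section FT

variable (N : Fin d → ℕ) [hN : ∀ μ, NeZero (N μ)]

/-- Pointwise Fourier inversion, solved for the field: `φ(y) = |Ω|⁻¹ Σ_p φ̃(p) e^{ip·y}`. [cite: King1986, (4.1) p.670] -/
theorem apply_eq_inversion (x : Tor N → ℝ) (y : Tor N) :
    (x y : ℂ) = (Fintype.card (Tor N) : ℂ)⁻¹ * ∑ p : Tor N, ft N x p * chi N p y := by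
  have hc : (Fintype.card (Tor N) : ℂ) ≠ 0 := by exact_mod_cast Fintype.card_ne_zero
  rw [inversion, ← mul_assoc, inv_mul_cancel₀ hc, one_mul]

/-- The Fourier transform of a scalar multiple. [folklore] -/
private theorem ft_smul (c : ℝ) (x : Tor N → ℝ) (p : Tor N) :
    ft N (c • x) p = (c : ℂ) * ft N x p := by
  unfold ft
  rw [Finset.mul_sum]
  refine Finset.sum_congr rfl fun y _ => ?_
  rw [Pi.smul_apply, smul_eq_mul, Complex.ofReal_mul, mul_assoc]

/-- The Fourier transform of a point source is a plane wave: `δ̃_b(q) = e^{−iq·b}`. [cite: King1986, (4.1) p.670] -/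
theorem ft_single (b q : Tor N) : ft N (Pi.single b 1) q = conj (chi N q b) := by
  unfold ft
  rw [Finset.sum_eq_single b]
  · simp
  · intro y _ hy
    rw [Pi.single_eq_of_ne hy]; simp
  · intro h; exact absurd (Finset.mem_univ b) h

/-- **The Fourier transform of `Tv` through the momentum kernel of `T`**:
`(Tv)^(p) = |Ω|⁻¹ Σ_{p′} conj T̂(p,p′) · v̂(p′)` (substitute the inversion formula for `v`; with the tree's
conventions `v̂(p) = Σ_y v(y)e^{−ip·y}`, `T̂(p,p′) = Σ e^{ip·y}T_{yy′}e^{−ip′·y′}`). [cite: BFKT2016Bloch, Lemma 6] -/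
theorem ft_mulVec (T : Matrix (Tor N) (Tor N) ℝ) (v : Tor N → ℝ) (p : Tor N) :
    ft N (T *ᵥ v) p = (Fintype.card (Tor N) : ℂ)⁻¹ * ∑ p', conj (hat N T p p') * ft N v p' := by
  set c : ℂ := (Fintype.card (Tor N) : ℂ)⁻¹ with hc
  have hconj : ∀ p', conj (hat N T p p') = ∑ y, ∑ y', conj (chi N p y) * (T y y' : ℂ) * chi N p' y' := by
    intro p'
    unfold hat
    rw [map_sum]
    refine Finset.sum_congr rfl fun y _ => ?_
    rw [map_sum]
    refine Finset.sum_congr rfl fun y' _ => ?_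
    rw [map_mul, map_mul, Complex.conj_ofReal, Complex.conj_conj]
  -- the left side as a triple sum
  have hL : ft N (T *ᵥ v) p
      = ∑ y, ∑ y', ∑ p', c * ((T y y' : ℂ) * ft N v p' * (chi N p' y' * conj (chi N p y))) := by
    show (∑ y, (((T *ᵥ v) y : ℝ) : ℂ) * conj (chi N p y)) = _
    refine Finset.sum_congr rfl fun y _ => ?_
    simp only [Matrix.mulVec, dotProduct]
    push_cast
    rw [Finset.sum_mul]
    refine Finset.sum_congr rfl fun y' _ => ?_
    rw [apply_eq_inversion N v y', ← hc, Finset.mul_sum, Finset.mul_sum, Finset.sum_mul]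
    exact Finset.sum_congr rfl fun p' _ => by ring
  -- the right side as a triple sum
  have hR : c * ∑ p', conj (hat N T p p') * ft N v p'
      = ∑ p', ∑ y, ∑ y', c * ((T y y' : ℂ) * ft N v p' * (chi N p' y' * conj (chi N p y))) := by
    rw [Finset.mul_sum]
    refine Finset.sum_congr rfl fun p' _ => ?_
    rw [hconj, Finset.sum_mul, Finset.mul_sum]
    refine Finset.sum_congr rfl fun y _ => ?_
    rw [Finset.sum_mul, Finset.mul_sum]
    exact Finset.sum_congr rfl fun y' _ => by ring
  rw [hL, hR]
  calc ∑ y, ∑ y', ∑ p', c * ((T y y' : ℂ) * ft N v p' * (chi N p' y' * conj (chi N p y)))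
      = ∑ y, ∑ p', ∑ y', c * ((T y y' : ℂ) * ft N v p' * (chi N p' y' * conj (chi N p y))) :=
        Finset.sum_congr rfl fun y _ => Finset.sum_comm
    _ = ∑ p', ∑ y, ∑ y', c * ((T y y' : ℂ) * ft N v p' * (chi N p' y' * conj (chi N p y))) :=
        Finset.sum_comm

end FT

/-! ## §2 King's (4.2): the plane-wave representation of the minimiser `ψ_φ = aN^dA₀⁻¹Qᵀφ` -/

section Minimiser

variable (N : ℕ) [NeZero N] (M : Fin d → ℕ) [hM : ∀ μ, NeZero (M μ)]

/-- `(A₀⁻¹v)^(p) = Σ_{p′ ∈ fib(red p)} conj C(p,p′) v̂(p′)` — the momentum kernel of `A₀⁻¹` is block diagonal over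
the alias fibres with the Sherman–Morrison blocks (`hat_fineOp_inv`). [cite: BFKT2016Bloch, Lemma 6; King1986, (4.5) p.670] -/
theorem ft_fineOp_inv_mulVec {a c m2 : ℝ} (ha : 0 ≤ a) (hc : 0 ≤ c) (hm : 0 < m2)
    (v : Tor (fine N M) → ℝ) (p : Tor (fine N M)) :
    ft (fine N M) ((fineOp N M a c m2)⁻¹ *ᵥ v) p
      = ∑ p' ∈ fib N M (red N M p), conj (Cfib N M a c m2 (red N M p) p p') * ft (fine N M) v p' := by
  have hcard : (Fintype.card (Tor (fine N M)) : ℂ) ≠ 0 := by exact_mod_cast Fintype.card_ne_zero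
  rw [ft_mulVec]
  have hker : ∀ p', conj (hat (fine N M) (fineOp N M a c m2)⁻¹ p p') * ft (fine N M) v p'
      = (Fintype.card (Tor (fine N M)) : ℂ)
        * (if red N M p' = red N M p then conj (Cfib N M a c m2 (red N M p) p p') * ft (fine N M) v p'
           else 0) := by
    intro p'
    rw [hat_fineOp_inv N M ha hc hm, map_mul, map_natCast]
    split_ifs with h
    · ring
    · simp
  simp_rw [hker]
  rw [← Finset.mul_sum, ← mul_assoc, inv_mul_cancel₀ hcard, one_mul, Finset.sum_filter]

/-- The reduced momentum of `p` labels its own fibre: `p ∈ fib (red p)`. [folklore] -/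
private theorem mem_fib_red (p : Tor (fine N M)) : p ∈ fib N M (red N M p) := by
  simp [fib]

/-- `‖e^{ip·x}‖ = 1` for the torus characters. [folklore] -/
private theorem norm_chi_eq_one (K : Fin d → ℕ) [∀ μ, NeZero (K μ)] (p x : Tor K) : ‖chi K p x‖ = 1 := by
  unfold chi
  rw [norm_prod]
  exact Finset.prod_eq_one fun μ _ => by rw [ZMod.stdAddChar_apply, Circle.norm_coe]

/-- **`(A₀⁻¹Qᵀφ)^(p) = conj u(p) · Δ^η(p)⁻¹ · (1 + aS(q))⁻¹ · φ̃(q)`, `q = red p`** — the fibre inverse applied to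
`(Qᵀφ)^ = conj u · φ̃∘red` (Sherman–Morrison: `Σ_{p′} C(p,p′)u(p′) = u(p)σ(p)⁻¹(1 − κS) = u(p)σ(p)⁻¹(1+aS)⁻¹`).
[cite: King1986, (4.2)/(4.5) p.670; BFKT2016Bloch, Lemma 9] -/
theorem ft_fineOp_inv_transpose_Qmat {a c m2 : ℝ} (ha : 0 ≤ a) (hc : 0 ≤ c) (hm : 0 < m2)
    (φ : Tor M → ℝ) (p : Tor (fine N M)) :
    ft (fine N M) ((fineOp N M a c m2)⁻¹ *ᵥ ((Qmat N M)ᵀ *ᵥ φ)) p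
      = (((lapSym (fine N M) c m2 p)⁻¹ * (1 + a * Sfib N M c m2 (red N M p))⁻¹ : ℝ) : ℂ)
          * conj (u N M p) * ft M φ (red N M p) := by
  rw [ft_fineOp_inv_mulVec N M ha hc hm]
  have hterm : ∀ p' ∈ fib N M (red N M p),
      conj (Cfib N M a c m2 (red N M p) p p') * ft (fine N M) ((Qmat N M)ᵀ *ᵥ φ) p'
        = conj (Cfib N M a c m2 (red N M p) p p' * u N M p') * ft M φ (red N M p) := by
    intro p' hp'
    have hq : red N M p' = red N M p := by simpa [fib] using hp'
    rw [ft_transpose_Qmat, hq, map_mul, mul_assoc]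
  rw [Finset.sum_congr rfl hterm, ← Finset.sum_mul, ← map_sum, sum_Cfib_mul_u (red N M p) (mem_fib_red N M p),
    one_sub_kap_mul_cast]
  · simp only [map_mul, map_div₀, Complex.conj_ofReal]
    push_cast
    ring
where
  /-- cast form of `1 − κS = (1 + aS)⁻¹` -/
  one_sub_kap_mul_cast :
      (1 : ℂ) - (kap N M a c m2 (red N M p) : ℂ) * (Sfib N M c m2 (red N M p) : ℂ)
        = (((1 + a * Sfib N M c m2 (red N M p))⁻¹ : ℝ) : ℂ) := by
    have h := one_sub_kap_mul (N := N) (M := M) ha hc hm (red N M p)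
    rw [← h]; push_cast; ring

/-- **`ψ̂_φ(p) = N^d·Δ^{(k)}(q)·Δ^η(p)⁻¹·conj u(p)·φ̃(q)`**, `q = red p`, `Δ^{(k)} = a/(1 + aS) = effSym`: the Fourier
transform of King's minimiser `ψ_φ = aN^dA₀⁻¹Qᵀφ`. [cite: King1986, (4.2) p.670, (2.15) p.653] -/
theorem ft_minimiser {a c m2 : ℝ} (ha : 0 ≤ a) (hc : 0 ≤ c) (hm : 0 < m2) (φ : Tor M → ℝ)
    (p : Tor (fine N M)) :
    ft (fine N M) (minimiser N M a c m2 φ) p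
      = (((N : ℝ) ^ d * (effSym N M a c m2 (red N M p) * (lapSym (fine N M) c m2 p)⁻¹) : ℝ) : ℂ)
          * conj (u N M p) * ft M φ (red N M p) := by
  unfold minimiser
  rw [ft_smul, ft_fineOp_inv_transpose_Qmat N M ha hc hm, effSym, div_eq_mul_inv]
  push_cast
  ring

/-- **KING'S (4.2) ON THE TORUS**: for `a ≥ 0`, `c ≥ 0`, `m² > 0` and every field `φ` on the unit torus,
`ψ_φ(x) = |Ω|⁻¹ Σ_{p ∈ Ω̂_η} Δ^{(k)}(q) Δ^η(p)⁻¹ conj u(p) φ̃(q) e^{ip·x}` (`q = red p`) — the torus form of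
`(a_kG_kQ_k^*φ)(x) = (2π)^{−d}∫dp′ Δ^{(k)}(p′) Σ_l e^{i(p′+l)x} u(p′+l)Δ^η(p′+l)⁻¹ φ̃(p′)` (the sum over `p` is the
integral over `p′` times the alias sum over `l`; the tree's alias weight `u` is the complex conjugate of King's
`u_k^η`). [cite: King1986, (4.2) p.670] -/
theorem minimiser_eq_sum {a c m2 : ℝ} (ha : 0 ≤ a) (hc : 0 ≤ c) (hm : 0 < m2) (φ : Tor M → ℝ)
    (x : Tor (fine N M)) :
    ((minimiser N M a c m2 φ x : ℝ) : ℂ)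
      = (Fintype.card (Tor M) : ℂ)⁻¹
        * ∑ p : Tor (fine N M), ((effSym N M a c m2 (red N M p) * (lapSym (fine N M) c m2 p)⁻¹ : ℝ) : ℂ)
            * conj (u N M p) * ft M φ (red N M p) * chi (fine N M) p x := by
  have hN : (N : ℂ) ^ d ≠ 0 := pow_ne_zero _ (by exact_mod_cast NeZero.ne N)
  have hcard : (Fintype.card (Tor M) : ℂ) ≠ 0 := by exact_mod_cast Fintype.card_ne_zero
  rw [apply_eq_inversion (fine N M) (minimiser N M a c m2 φ) x, card_fine, Finset.mul_sum, Finset.mul_sum]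
  refine Finset.sum_congr rfl fun p _ => ?_
  rw [ft_minimiser N M ha hc hm]
  push_cast
  field_simp

/-- **THE MINIMISER KERNEL** `ℋ_k(x, b) = ψ_{δ_b}(x) = |Ω|⁻¹ Σ_p Δ^{(k)}(q)Δ^η(p)⁻¹ conj u(p) e^{−iq·b} e^{ip·x}` —
(4.2) with `y = b` (a point of the unit torus). [cite: King1986, (4.2) p.670] -/
theorem minimiser_kernel_eq_sum {a c m2 : ℝ} (ha : 0 ≤ a) (hc : 0 ≤ c) (hm : 0 < m2) (b : Tor M)
    (x : Tor (fine N M)) :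
    ((minimiser N M a c m2 (Pi.single b 1) x : ℝ) : ℂ)
      = (Fintype.card (Tor M) : ℂ)⁻¹
        * ∑ p : Tor (fine N M), ((effSym N M a c m2 (red N M p) * (lapSym (fine N M) c m2 p)⁻¹ : ℝ) : ℂ)
            * conj (u N M p) * conj (chi M (red N M p) b) * chi (fine N M) p x := by
  rw [minimiser_eq_sum N M ha hc hm]
  simp_rw [ft_single]

/-- The effective symbol is nonnegative (`a ≥ 0`, `c ≥ 0`, `m² > 0`). [cite: King1986, (4.5) p.670] -/
theorem effSym_nonneg {a c m2 : ℝ} (ha : 0 ≤ a) (hc : 0 ≤ c) (hm : 0 < m2) (q : Tor M) :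
    0 ≤ effSym N M a c m2 q := by
  unfold effSym
  have hS := Sfib_nonneg (N := N) (M := M) hc hm q
  positivity

/-- **UNIFORM BOUND BY THE ALIAS AMPLITUDES**: `|ℋ_k(x, b)| ≤ |Ω|⁻¹ Σ_q Σ_{p ∈ fib q} Δ^{(k)}(q)Δ^η(p)⁻¹‖u(p)‖` —
the size of the kernel is at most the average over the reduced momenta of the alias sums of the mode amplitudes
(`|e^{ip·x}| = |e^{−iq·b}| = 1`); the alias sums are King's Σ_l of (4.2), bounded uniformly by (4.20)–(4.22).
[cite: King1986, (4.2) p.670, (4.20)–(4.22) p.672] -/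
theorem abs_minimiser_kernel_le {a c m2 : ℝ} (ha : 0 ≤ a) (hc : 0 ≤ c) (hm : 0 < m2) (b : Tor M)
    (x : Tor (fine N M)) :
    |minimiser N M a c m2 (Pi.single b 1) x|
      ≤ (Fintype.card (Tor M) : ℝ)⁻¹
        * ∑ q : Tor M, ∑ p ∈ fib N M q,
            effSym N M a c m2 q * (lapSym (fine N M) c m2 p)⁻¹ * ‖u N M p‖ := by
  have hnorm : |minimiser N M a c m2 (Pi.single b 1) x|
      = ‖((minimiser N M a c m2 (Pi.single b 1) x : ℝ) : ℂ)‖ := by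
    rw [Complex.norm_real, Real.norm_eq_abs]
  rw [hnorm, minimiser_kernel_eq_sum N M ha hc hm, norm_mul, norm_inv, Complex.norm_natCast]
  refine mul_le_mul_of_nonneg_left ?_ (by positivity)
  -- regroup the momenta by fibres and bound termwise
  rw [← Finset.sum_fiberwise Finset.univ (red N M)
    (fun p => ((effSym N M a c m2 (red N M p) * (lapSym (fine N M) c m2 p)⁻¹ : ℝ) : ℂ)
      * conj (u N M p) * conj (chi M (red N M p) b) * chi (fine N M) p x)]
  refine (norm_sum_le _ _).trans (Finset.sum_le_sum fun q _ => (norm_sum_le _ _).trans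
    (Finset.sum_le_sum fun p hp => ?_))
  have hq : red N M p = q := by simpa [fib] using hp
  have hpos : 0 ≤ effSym N M a c m2 q * (lapSym (fine N M) c m2 p)⁻¹ :=
    mul_nonneg (effSym_nonneg N M ha hc hm q)
      (inv_nonneg.mpr ((hm.le).trans (lapSym_ge (fine N M) c m2 hc p)))
  rw [hq, conj_chi, norm_mul, norm_mul, norm_mul, norm_chi_eq_one, norm_chi_eq_one, mul_one, mul_one,
    RCLike.norm_conj, Complex.norm_real, Real.norm_eq_abs, abs_of_nonneg hpos]

end Minimiser

end Torus

end Literature.MathematicalPhysics.QuantumFieldTheory.King1986
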